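import Literature.Probability.RandomPlanarGeometry.SLESixHullLocalityFact
import Literature.Probability.RandomPlanarGeometry.LoewnerImageStoppedClass
import Literature.Probability.RandomPlanarGeometry.SLEImageLocalisationPaths
import Literature.Probability.RandomPlanarGeometry.SLESixHullLocalityEvents
import Literature.Probability.RandomPlanarGeometry.SLETraceHittingMarkov
import Literature.Probability.RandomPlanarGeometry.SLETraceGeneralBM
import Literature.Probability.RandomPlanarGeometry.SLETraceApproximation
import Literature.Probability.RandomPlanarGeometry.RohdeSchrammCor35Proofs
import Literature.Probability.RandomPlanarGeometry.LocalMartingaleProofs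
import Mathlib.Probability.BrownianMotion.Basic
import HarnessLib

/-!
# Locality of chordal SLE₆ with respect to a bounded hull (alive form): the probabilistic assembly

Topic `Probability/RandomPlanarGeometry`; theorems only. We derive the named fact
`sle_six_hull_locality_alive` (`SLESixHullLocalityFact.lean`; Lawler–Schramm–Werner (2001)
Thm. 2.2 / (2003) §5) from the two outputs of the stochastic part of the conformal-image chain
(worker files `SLEImage*.lean`, crux `stmt-CriticalPhenomena-0698`, stub `stub_isLocal`), taken
here as hypotheses in their pinned form:

* (BM) **the image Brownian motion at level `n`**: on the product of two Wiener spaces there is a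
  Brownian motion `B̂` with `√6 · B̂_s = (W̃ ∘ τ)(s) = imageDriverC W A T₀ s` for all capacity times
  `s ≤ σ(T₀)`, `T₀ = imgLocTimeK 6 hA hne n ω > 0` the localising time (Itô at `κ = 6`,
  Dambis–Dubins–Schwarz, concatenation);
* (EX) **the localising times exhaust the alive times**: if the closed hull at `t` misses `A`
  then `t < imgLocTimeK 6 hA hne m ω` for all large `m`.

Proof of `sle_six_hull_locality_alive_of_imageBM`. Let `Z` be the class of `E_A ∘ γ` stopped at
`T = firstHit γ S'` and `Z'` the class of `γ` stopped at `firstHit γ S`. With the measurable path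
functional `G η = stopClass (traceOf η) (firstHit (traceOf η) S)`: (a) `Z' = G (drivingPath)` a.s.;
(b) at level `n`, on the event `Eₙ = {T < imgLocTimeK n}` the chain of `Û = √6 B̂` is generated by a
curve `γ̂` (Rohde–Schramm for a general Brownian motion) which is `E_A ∘ γ ∘ τ` up to `σ T`
(`Loewner.apply_clockC_eq_of_isGeneratedByCurve`, `LoewnerImageTip.lean`), and it first hits `S`
exactly at `σ T` (dictionary `z ∈ S' ↔ E_A z ∈ S` off `A`), so `Z = G (Û)` on `Eₙ`
(`Loewner.stoppedPathClass_starMap_eq_stopClass`); (c) `Û` has the path law of the SLE₆ driver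
(`map_eq_map_drivingPath`), so `P{G(Û) ∈ T} = P{Z' ∈ T}` for every `n`, while
`|P{Z ∈ T} − P{G(Û) ∈ T}| ≤ P(Eₙᶜ) → 0` by (EX) and the alive hypothesis. Hence `P{Z ∈ T} = P{Z' ∈ T}`.

References: LSW, Acta Math. 187 (2001) Thm. 2.2; JAMS 16 (2003) §5; Lawler (2005) §4.6, §6.3.
-/

noncomputable section

open Set Filter Topology Function Complex Metric MeasureTheory ProbabilityTheory
open UpperHalfPlane (upperHalfPlaneSet)
open scoped NNReal unitInterval ENNReal

namespace Literature.Probability.RandomPlanarGeometry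

open Literature.Probability.Process Loewner
open scoped PathBorel

/-! ### The image curve first hits `S` at the capacity time of the first hit of `S'` -/

section Dictionary

variable {W U' : ℝ≥0 → ℝ} {A S S' : Set ℂ}

/-- **Dictionary of first hits.** In the setting of `Loewner.apply_clockC_eq_of_isGeneratedByCurve`
(chain of `W` generated by `γ`, alive at the horizon `β`; `U'` equal to the image driver up to
`σ β₂`, `β₂ < β`, generated by `γ̂`), if `z ∈ S' ↔ E_A z ∈ S` off `A` on the closed half-plane and
`γ` first hits the closed set `S'` at `t ≤ β₂`, then `γ̂` first hits the closed set `S` at `σ t`.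
[cite: LawlerSchrammWerner2003Restriction, §5] -/
theorem firstHit_imageTrace_eq (hW : Continuous W) (hW0 : W 0 = 0) (hA : IsStarHull A) (hne : A.Nonempty)
    {β : ℝ≥0} (hβ : Disjoint (closedHull W β) A) (hU' : Continuous U') {β₂ : ℝ≥0} (hβ₂ : β₂ < β)
    (hagree : ∀ s, s ≤ clockC W A β₂ → U' s = imageDriverC W A β s) {γ γ' : ℝ≥0 → ℂ}
    (hγ : IsGeneratedByCurve W γ) (hγ' : IsGeneratedByCurve U' γ') (hS : IsClosed S) (hS' : IsClosed S')
    (hdict : ∀ z : ℂ, 0 ≤ z.im → z ∉ A → (z ∈ S' ↔ starMap A z ∈ S)) {t : ℝ≥0} (ht : firstHit γ S' = t)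
    (htβ : t ≤ β₂) : firstHit γ' S = clockC W A t := by
  have htip : ∀ u, u ≤ β₂ → γ' (clockC W A u) = starMap A (γ u) := fun u hu ↦
    apply_clockC_eq_of_isGeneratedByCurve hW hA hne hβ hU' hβ₂ hagree hW0 hγ hγ' hu
  have hnotA : ∀ u, u ≤ β₂ → γ u ∉ A := fun u hu ↦
    hγ.apply_notMem_of_alive hW (alive_mono hβ₂.le hβ) hu
  have him := hγ.im_nonneg
  have htβ' : t ≤ β := htβ.trans hβ₂.le
  -- `γ t ∈ S'`, so `γ̂ (σ t) ∈ S`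
  obtain ⟨t₀, ht₀, hγt⟩ := exists_firstHit_eq_coe hγ.continuous hS' (by rw [ht]; exact WithTop.coe_ne_top)
  obtain rfl : t₀ = t := WithTop.coe_injective (ht₀.symm.trans ht)
  have hmem : γ' (clockC W A t₀) ∈ S := by
    rw [htip t₀ htβ]; exact (hdict _ (him t₀) (hnotA t₀ htβ)).1 hγt
  refine le_antisymm (firstHit_le hmem) ?_
  -- before `σ t` the image curve is off `S`
  by_contra hlt
  push Not at hlt
  obtain ⟨q, hq, hγ'q⟩ := exists_firstHit_eq_coe hγ'.continuous hS (ne_top_of_lt hlt)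
  rw [hq] at hlt
  have hqlt : q < clockC W A t₀ := WithTop.coe_lt_coe.1 hlt
  have hσt : ((clockC W A t₀ : ℝ≥0) : ℝ) = imageClock W A t₀ := coe_clockC hW hA hne hβ htβ'
  have htI : (t₀ : ℝ) ∈ Icc (0 : ℝ) β := ⟨t₀.coe_nonneg, NNReal.coe_le_coe.2 htβ'⟩
  have hσβ : imageClock W A t₀ ≤ imageClock W A β :=
    (strictMonoOn_imageClock hW hA hne hβ).monotoneOn htI ⟨β.coe_nonneg, le_rfl⟩ (NNReal.coe_le_coe.2 htβ')
  have hqI : (q : ℝ) ∈ Icc (0 : ℝ) (imageClock W A β) :=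
    ⟨q.coe_nonneg, ((NNReal.coe_le_coe.2 hqlt.le).trans_eq hσt).trans hσβ⟩
  -- `q = σ u` with `u = τ q < t`
  set u : ℝ≥0 := (imageClockInv W A β q).toNNReal with hudef
  obtain ⟨huI, hσu'⟩ := imageClockInv_spec hW hA hne hβ hqI
  have huβ : u ≤ β := by
    rw [hudef, ← NNReal.coe_le_coe, Real.coe_toNNReal _ huI.1]; exact huI.2
  have hσu : clockC W A u = q := by
    rw [hudef, clockC_toNNReal_imageClockInv hW hA hne hβ hqI, Real.toNNReal_coe]
  have hut : u < t₀ := by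
    by_contra hle
    push Not at hle
    have h1 := clockC_mono hW hA hne hβ hle huβ
    rw [hσu] at h1
    exact absurd hqlt (not_lt.2 h1)
  have hγ'q' : γ' q = starMap A (γ u) := by rw [← hσu]; exact htip u (hut.le.trans htβ)
  have hnotS' : γ u ∉ S' := notMem_of_lt_firstHit (by rw [ht]; exact_mod_cast hut)
  rw [hγ'q'] at hγ'q
  exact hnotS' ((hdict _ (him u) (hnotA u (hut.le.trans htβ))).2 hγ'q)

end Dictionary

/-! ### The theorem -/

section Main

/-- **Locality of chordal SLE₆ with respect to a bounded hull, alive form, from the image Brownian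
motion** (`sle_six_hull_locality_alive`; [LSW 2001] Thm. 2.2, [LSW 2003] §5): given (BM) the image
Brownian motion at every level `n` (Itô at `κ = 6` + Dambis–Dubins–Schwarz + concatenation on the
product of two Wiener spaces) and (EX) the exhaustion of the alive times by the localising times,
the class of `E_A ∘ γ` stopped at the first hit `T` of `S'` has the law of the class of the SLE₆
trace stopped at its first hit of `S`, provided the path is a.s. alive at `T`. See the module
docstring for the proof. [cite: LawlerSchrammWerner2001, Thm 2.2] -/
theorem sle_six_hull_locality_alive_of_imageBM
    (hBM : ∀ {A : Set ℂ} (hA : IsStarHull A) (hne : A.Nonempty) (n : ℕ),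
      ∃ Bc : ℝ≥0 → (ℝ≥0 → ℝ) × (ℝ≥0 → ℝ) → ℝ,
        IsBrownianReal Bc (preWienerMeasure.prod preWienerMeasure) ∧
        (∀ s, Measurable (Bc s)) ∧ (∀ z, Continuous (Bc · z)) ∧
        ∀ (z : (ℝ≥0 → ℝ) × (ℝ≥0 → ℝ)) (T₀ : ℝ≥0), imgLocTimeK 6 hA hne n z.1 = T₀ → 0 < T₀ →
          ∀ s : ℝ≥0, (s : ℝ) ≤ imageClock (drvK 6 (brownianCPath z.1)) A T₀ →
            Real.sqrt 6 * Bc s z = imageDriverC (drvK 6 (brownianCPath z.1)) A T₀ s)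
    (hEX : ∀ {A : Set ℂ} (hA : IsStarHull A) (hne : A.Nonempty) {ω : ℝ≥0 → ℝ} {t : ℝ≥0},
      Disjoint (closedHull (drvK 6 (brownianCPath ω)) t) A →
        ∀ᶠ m in atTop, (t : WithTop ℝ≥0) < imgLocTimeK 6 hA hne m ω) :
    sle_six_hull_locality_alive := by
  intro A hA hne S S' hS hS' hdict halive T hT
  haveI := isProbabilityMeasure_preWienerMeasure'
  set P : Measure (ℝ≥0 → ℝ) := preWienerMeasure with hPdef
  set μ2 : Measure ((ℝ≥0 → ℝ) × (ℝ≥0 → ℝ)) := P.prod P with hμ2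
  have hfst : Measure.QuasiMeasurePreserving Prod.fst μ2 P := Measure.quasiMeasurePreserving_fst
  have h60 : (6 : ℝ≥0) ≠ 0 := by norm_num
  have h68 : (6 : ℝ≥0) ≠ 8 := by norm_num
  have hgen : ∀ᵐ ω ∂P, ∃ γ, IsGeneratedByCurve (sleDriving 6 ω) γ := hasSLETrace_of_ne_eight_apply h68
  have hWeq : ∀ ω, drvK 6 (brownianCPath ω) = sleDriving 6 ω := drvK_brownianCPath 6
  -- the random classes of the statement
  set Z : (ℝ≥0 → ℝ) → CurveClass ℂ := fun ω ↦ stoppedPathClass (starMap A) (sleTrace 6 ω)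
    ((firstHit (sleTrace 6 ω) S').untopD 0) with hZ
  set Z' : (ℝ≥0 → ℝ) → CurveClass ℂ := fun ω ↦ stoppedPathClass id (sleTrace 6 ω)
    ((firstHit (sleTrace 6 ω) S).untopD 0) with hZ'
  change P {ω | Z ω ∈ T} = P {ω | Z' ω ∈ T}
  -- the path functional
  set G : C(ℝ≥0, ℝ) → CurveClass ℂ := fun η ↦ stopClass (traceOf η) ((firstHit (traceOf η) S).untopD 0)
    with hGdef
  have hGm : Measurable G := measurable_stopClass_traceOf_firstHit hS
  have hGT : MeasurableSet {η | G η ∈ T} := hGm hT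
  -- (a) the plain side: `Z' = G ∘ drivingPath` a.e.
  have hZ'G : ∀ᵐ ω ∂P, Z' ω = G (drivingPath 6 ω) := by
    filter_upwards [hgen] with ω hgω
    have htr : ⇑(traceOf (drivingPath 6 ω)) = sleTrace 6 ω := coe_traceOf_drivingPath hgω
    show stoppedPathClass id (sleTrace 6 ω) ((firstHit (sleTrace 6 ω) S).untopD 0) =
      stopClass (traceOf (drivingPath 6 ω)) ((firstHit (traceOf (drivingPath 6 ω)) S).untopD 0)
    rw [stoppedPathClass_eq_stopClass (traceOf (drivingPath 6 ω)) (fun t ↦ by rw [htr]; rfl), htr]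
  have hR : P {ω | Z' ω ∈ T} = P {ω | G (drivingPath 6 ω) ∈ T} := by
    refine measure_congr ?_
    filter_upwards [hZ'G] with ω hω
    show (Z' ω ∈ T) = (G (drivingPath 6 ω) ∈ T)
    rw [hω]
  -- a measurable version of the `S'`-hitting time and the exhaustion events
  obtain ⟨τS, hσst, hσeq⟩ := exists_isStoppingTime_rightCont_ae_eq_hitting
    (hasSLETrace_of_ne_eight_apply h68) hS'
  have hσ' : ∀ᵐ ω ∂P, τS ω = firstHit (sleTrace 6 ω) S' := by
    filter_upwards [hσeq] with ω hω
    rw [hω, ← firstHit_eq_hittingAfter (fun t ω ↦ sleTrace 6 ω t) S' ω]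
  set E : ℕ → Set ((ℝ≥0 → ℝ) × (ℝ≥0 → ℝ)) := fun m ↦ {z | τS z.1 < imgLocTimeK 6 hA hne m z.1} with hE
  have hEmeas : ∀ m, MeasurableSet (E m) := fun m ↦
    (measurableSet_setOf_lt_of_isStoppingTime hσst (isStoppingTime_imgLocTimeK m)).preimage measurable_fst
  have hev : ∀ᵐ z ∂μ2, ∀ᶠ m in atTop, z ∈ E m := by
    have h1 : ∀ᵐ ω ∂P, ∀ᶠ m in atTop, τS ω < imgLocTimeK 6 hA hne m ω := by
      filter_upwards [halive, hσ'] with ω hal hσω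
      obtain ⟨t, ht, halt⟩ := hal
      rw [hσω, ht]
      rw [← hWeq] at halt
      exact hEX hA hne halt
    exact hfst.ae h1
  have htend : Tendsto (fun m ↦ μ2 (E m)ᶜ) atTop (𝓝 0) :=
    tendsto_measure_compl_of_ae_eventually_mem hEmeas hev
  -- (b) + (c): the two-sided bound at every level
  have hL : μ2 {z | Z z.1 ∈ T} = P {ω | Z ω ∈ T} := measure_prod_preimage_fst P P {ω | Z ω ∈ T}
  have hbound : ∀ m, P {ω | Z ω ∈ T} ≤ P {ω | Z' ω ∈ T} + μ2 (E m)ᶜ ∧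
      P {ω | Z' ω ∈ T} ≤ P {ω | Z ω ∈ T} + μ2 (E m)ᶜ := by
    intro m
    obtain ⟨Bc, hBcBM, hBcm, hBcc, hagree⟩ := hBM hA hne m
    set U : (ℝ≥0 → ℝ) × (ℝ≥0 → ℝ) → ℝ≥0 → ℝ := fun z s ↦ Real.sqrt 6 * Bc s z with hUdef
    set Upath : (ℝ≥0 → ℝ) × (ℝ≥0 → ℝ) → C(ℝ≥0, ℝ) := fun z ↦
      (⟨fun t ↦ Real.sqrt 6 * Bc t z, continuous_const.mul (hBcc z)⟩ : C(ℝ≥0, ℝ)) with hUpath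
    have hUm : Measurable Upath :=
      Process.measurable_continuousMap_of_eval fun t ↦ (hBcm t).const_mul _
    have hlawU : μ2.map Upath = P.map (drivingPath 6) :=
      map_eq_map_drivingPath 6 exists_isBrownianReal_measurable_continuous_holds hBcBM hBcc hBcm
    have hgenU : ∀ᵐ z ∂μ2, ∃ γ', IsGeneratedByCurve (U z) γ' :=
      ae_isGeneratedByCurve_of_isBrownianReal hBcBM hBcc h60 h68
    -- identification on `E m`
    have hB : ∀ᵐ z ∂μ2, z ∈ E m → Z z.1 = G (Upath z) := by
      filter_upwards [hgenU, hfst.ae hgen, hfst.ae hσ', hfst.ae halive] with z hγ' hgω hσω hal hzE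
      obtain ⟨γ', hγ'⟩ := hγ'
      set ω := z.1 with hωdef
      obtain ⟨t, ht, halt⟩ := hal
      -- the localising time `T₀ > t`
      obtain ⟨T₀, hT₀⟩ := WithTop.ne_top_iff_exists.1 (imgLocTimeK_ne_top (κ := 6) (hA := hA) (hne := hne) m ω)
      have hzE' : τS ω < imgLocTimeK 6 hA hne m ω := hzE
      rw [hσω, ht, ← hT₀] at hzE'
      have htT : t < T₀ := WithTop.coe_lt_coe.1 hzE'
      have hT0pos : 0 < T₀ := lt_of_le_of_lt bot_le htT
      have hT0pos' : (0 : WithTop ℝ≥0) < imgLocTimeK 6 hA hne m ω := by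
        rw [← hT₀]; exact WithTop.coe_lt_coe.2 hT0pos
      have haliveT : Disjoint (closedHull (sleDriving 6 ω) T₀) A := by
        have := (imgDrvP_eq_of_le (κ := 6) (hA := hA) (hne := hne) (n := m) (t := T₀) (ω := ω)
          (by rw [← hT₀]) hT0pos').1
        rwa [hWeq] at this
      have hWc : Continuous (sleDriving 6 ω) := continuous_sleDriving 6 ω
      have hW0 : sleDriving 6 ω 0 = 0 := sleDriving_zero 6 ω
      have hγgen : IsGeneratedByCurve (sleDriving 6 ω) (sleTrace 6 ω) := isGeneratedByCurve_trace hgω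
      -- agreement of `U z` with the image driver up to `σ t ≤ σ T₀`
      have hag : ∀ s, s ≤ clockC (sleDriving 6 ω) A t → U z s = imageDriverC (sleDriving 6 ω) A T₀ s := by
        intro s hs
        have hs' : (s : ℝ) ≤ imageClock (drvK 6 (brownianCPath z.1)) A T₀ := by
          rw [← hωdef, hWeq]
          calc (s : ℝ) ≤ clockC (sleDriving 6 ω) A t := NNReal.coe_le_coe.2 hs
            _ = imageClock (sleDriving 6 ω) A t := coe_clockC hWc hA hne haliveT htT.le
            _ ≤ imageClock (sleDriving 6 ω) A T₀ :=
                (strictMonoOn_imageClock hWc hA hne haliveT).monotoneOn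
                  ⟨t.coe_nonneg, NNReal.coe_le_coe.2 htT.le⟩ ⟨T₀.coe_nonneg, le_rfl⟩ (NNReal.coe_le_coe.2 htT.le)
        have h1 := hagree z T₀ (by rw [← hωdef]; exact hT₀.symm) hT0pos s hs'
        rw [← hωdef, hWeq] at h1
        exact h1
      have hU'c : Continuous (U z) := continuous_const.mul (hBcc z)
      have hγ'U : IsGeneratedByCurve (⇑(Upath z)) γ' := hγ'
      have htr : ⇑(traceOf (Upath z)) = γ' := coe_traceOf_eq hγ'U
      -- class identity and hitting dictionary (horizon `T₀`, `β₂ = t`)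
      have hcls := stoppedPathClass_starMap_eq_stopClass hWc hA hne haliveT hU'c htT hag hW0 hγgen hγ'
        (traceOf (Upath z)) (fun s ↦ by rw [htr]) le_rfl
      have hfh := firstHit_imageTrace_eq hWc hW0 hA hne haliveT hU'c htT hag hγgen hγ' hS hS' hdict ht le_rfl
      show stoppedPathClass (starMap A) (sleTrace 6 ω) ((firstHit (sleTrace 6 ω) S').untopD 0) =
        stopClass (traceOf (Upath z)) ((firstHit (traceOf (Upath z)) S).untopD 0)
      rw [htr, hfh, WithTop.untopD_coe, ht, WithTop.untopD_coe]
      exact hcls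
    -- the law of `G (Û)`
    have hlaw : μ2 {z | G (Upath z) ∈ T} = P {ω | Z' ω ∈ T} := by
      calc μ2 {z | G (Upath z) ∈ T} = μ2.map Upath {η | G η ∈ T} := (Measure.map_apply hUm hGT).symm
        _ = P.map (drivingPath 6) {η | G η ∈ T} := by rw [hlawU]
        _ = P {ω | G (drivingPath 6 ω) ∈ T} := Measure.map_apply (measurable_drivingPath 6) hGT
        _ = P {ω | Z' ω ∈ T} := hR.symm
    constructor
    · calc P {ω | Z ω ∈ T} = μ2 {z | Z z.1 ∈ T} := hL.symm
        _ ≤ μ2 ({z | G (Upath z) ∈ T} ∪ (E m)ᶜ) := by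
            refine measure_mono_ae ?_
            filter_upwards [hB] with z hz
            intro hzT
            by_cases hzE : z ∈ E m
            · left
              show G (Upath z) ∈ T
              rw [← hz hzE]; exact hzT
            · right; exact hzE
        _ ≤ μ2 {z | G (Upath z) ∈ T} + μ2 (E m)ᶜ := measure_union_le _ _
        _ = P {ω | Z' ω ∈ T} + μ2 (E m)ᶜ := by rw [hlaw]
    · calc P {ω | Z' ω ∈ T} = μ2 {z | G (Upath z) ∈ T} := hlaw.symm
        _ ≤ μ2 ({z | Z z.1 ∈ T} ∪ (E m)ᶜ) := by
            refine measure_mono_ae ?_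
            filter_upwards [hB] with z hz
            intro hzT
            by_cases hzE : z ∈ E m
            · left
              show Z z.1 ∈ T
              rw [hz hzE]; exact hzT
            · right; exact hzE
        _ ≤ μ2 {z | Z z.1 ∈ T} + μ2 (E m)ᶜ := measure_union_le _ _
        _ = P {ω | Z ω ∈ T} + μ2 (E m)ᶜ := by rw [hL]
  -- let `m → ∞`
  have hlimZ' : Tendsto (fun m ↦ P {ω | Z' ω ∈ T} + μ2 (E m)ᶜ) atTop (𝓝 (P {ω | Z' ω ∈ T})) := by
    have := (tendsto_const_nhds (x := P {ω | Z' ω ∈ T})).add htend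
    rwa [add_zero] at this
  have hlimZ : Tendsto (fun m ↦ P {ω | Z ω ∈ T} + μ2 (E m)ᶜ) atTop (𝓝 (P {ω | Z ω ∈ T})) := by
    have := (tendsto_const_nhds (x := P {ω | Z ω ∈ T})).add htend
    rwa [add_zero] at this
  exact le_antisymm (ge_of_tendsto' hlimZ' fun m ↦ (hbound m).1)
    (ge_of_tendsto' hlimZ fun m ↦ (hbound m).2)

end Main

end Literature.Probability.RandomPlanarGeometry

end
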